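import Mathlib.Analysis.SpecialFunctions.Pow.Real
import Mathlib.Algebra.Order.BigOperators.Ring.Finset
import HarnessLib

/-!
# `NoHeavyLowerTail` (crux stmt-CriticalPhenomena-4575), abstract sunflower cubic: the LINKED TWO-CURRENCY LEMMA and the
# two-linked-systems inequality (RES0′) for petal systems whose top `h`-cell is at its floor — every number of petals

Support file (seat `prim-ineq-prove-1` gen 52; `--supports stmt-CriticalPhenomena-4575`).  No `sorry`, no named facts,
Mathlib only.  Memo: run/shared/lean/prim/prim-ineq-prove-1/FINDING-TWOLINKED-prove1-g52.md §4.

CONTEXT.  The leaf-leaf edge conjecture (`…SunflowerLeafLeaf.LeafLeafSafe`, which gives an A-safe core to every cycle)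
is, as a section relaxation over the block `(z₁, z₂, u, w)`, a statement about ONE-COIN MIXTURES OF LINKED ONE-COIN SYSTEMS.
Its `z₂`-slice is the TWO-LINKED-SYSTEMS inequality (RES0′) (memo of gen 51 §5, gen 52 §0): petals
`G_j = c₀ + p·Ȳ_j + q·H_j` with `Ȳ_j = (1−s)y_j + s k_j`, `H_j = (1−σ)g_j + σ h_j`, floors `b_Ȳ`, `b_H`, Lemma-A budgets
`∏ Ȳ_j ≤ b_Ȳ^(n−1)`, `∏ H_j ≤ b_H^(n−1)`, and the single cross link `k_j ≥ g_j`; claim `∏ G_j ≤ g^(n−1)·a`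
(`g = G(floors)`, `a = c₀ + p + q`).  It is false for two unlinked systems and false with the bare constant `c₀ = τσ`
for `n ≥ 3` (gen 52 §2 (F2)); the leaf-leaf constant makes `(1−σ) b_Ȳ ≤ g`.

THIS FILE proves it for EVERY `n` in the case where the free-standing top cell `h` is at its floor (then the whole
`H`-excess is `g`-excess, which the link backs by `k`-excess), from an abstract inequality:

* **`linked_caps`** (the LINKED TWO-CURRENCY LEMMA at the caps).  `0 < τ < 1`, `b_j ≥ 0`, `τ·b_j ≤ (1−τ)·a_j` ⟹
  `∏ (1 + a_j + b_j) ≤ τ·∏ (1 + a_j/τ) + (1−τ)·∏ (1 + b_j/(1−τ))`.  Five-line induction: adding a petal `(a,b)` adds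
  `a·P_Y + b·P_H` on the right and multiplies the left by `1+a+b`; `L ≤ P_Y` termwise by the link, and either `L ≤ P_H`
  or `a(P_Y − L) − b(L − P_H) ≥ (a/τ)(τP_Y + (1−τ)P_H − L) ≥ 0` by induction.
* `rfun_anti` — `ε ↦ ε·(∏(1 + a_j/ε) − 1)` is antitone on `(0,∞)`; hence **`linked_two_currency`**: for
  `0 < ε_Y ≤ τ`, `0 < ε_H ≤ 1−τ`:  `∏(1+a_j+b_j) ≤ 1 + ε_Y(∏(1+a_j/ε_Y) − 1) + ε_H(∏(1+b_j/ε_H) − 1)`.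
  (Sharp: equality for `a_j = τ·x`, `b_j = (1−τ)x` families at the caps; false without the link.)
* **`res0_hfloor`** — (RES0′) for all `n` when `h ≡ α₁₁`: with `a_j = p(Ȳ_j − b_Ȳ)/g`, `b_j = q(1−σ)(g_j − α₀₁)/g` the
  link is `s(g_j − α₀₁) ≤ Ȳ_j − b_Ȳ` (i.e. `k_j ≥ g_j`, `y_j ≥ α₀₀`), `ε_Y = p b_Ȳ/g ≤ τ` is the leaf-leaf constant
  condition `(1−σ)b_Ȳ ≤ g`, `ε_H = q b_H/g ≤ 1−τ` is `s b_H ≤ g`, and the two face budgets finish.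
The `h`-active case (the remaining content of (RES0′), hence of the `z₂`-slice of the leaf-leaf lemma) is open; see the memo
§2 for what does NOT work.
-/

noncomputable section

namespace Summit.CriticalPhenomena.PercolationContinuityZ3.Theorems.SunflowerPartition

namespace SafeCalc

namespace LinkedCurrency

open Finset

variable {κ : Type*}

/-! ## The linked two-currency lemma at the caps -/

/-- **Linked two-currency lemma, cap form.**  For `0 < τ < 1` and petals with `b_j ≥ 0`, `τ b_j ≤ (1−τ) a_j`:
`∏_{j∈S} (1 + a_j + b_j) ≤ τ ∏_{j∈S} (1 + a_j/τ) + (1−τ) ∏_{j∈S} (1 + b_j/(1−τ))`. [this work] -/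
theorem linked_caps [DecidableEq κ] {τ : ℝ} (hτ0 : 0 < τ) (hτ1 : τ < 1) (a b : κ → ℝ) (S : Finset κ)
    (hb : ∀ j ∈ S, 0 ≤ b j) (hlink : ∀ j ∈ S, τ * b j ≤ (1 - τ) * a j) :
    ∏ j ∈ S, (1 + a j + b j) ≤ τ * ∏ j ∈ S, (1 + a j / τ) + (1 - τ) * ∏ j ∈ S, (1 + b j / (1 - τ)) := by
  have hτ1' : 0 < 1 - τ := sub_pos.2 hτ1
  -- nonnegativity of `a` from the link
  have ha : ∀ j ∈ S, 0 ≤ a j := fun j hj => by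
    have h := hlink j hj
    have h2 : 0 ≤ τ * b j := mul_nonneg hτ0.le (hb j hj)
    nlinarith
  induction S using Finset.induction_on with
  | empty => simp
  | @insert i S hi ih =>
    have hbS : ∀ j ∈ S, 0 ≤ b j := fun j hj => hb j (mem_insert_of_mem hj)
    have hlS : ∀ j ∈ S, τ * b j ≤ (1 - τ) * a j := fun j hj => hlink j (mem_insert_of_mem hj)
    have haS : ∀ j ∈ S, 0 ≤ a j := fun j hj => ha j (mem_insert_of_mem hj)
    have IH := ih hbS hlS haS
    set L := ∏ j ∈ S, (1 + a j + b j) with hL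
    set PY := ∏ j ∈ S, (1 + a j / τ) with hPY
    set PH := ∏ j ∈ S, (1 + b j / (1 - τ)) with hPH
    have hai : 0 ≤ a i := ha i (mem_insert_self i S)
    have hbi : 0 ≤ b i := hb i (mem_insert_self i S)
    have hli : τ * b i ≤ (1 - τ) * a i := hlink i (mem_insert_self i S)
    have hL0 : 0 ≤ L := prod_nonneg fun j hj => by have := haS j hj; have := hbS j hj; linarith
    have hPH0 : 0 ≤ PH := prod_nonneg fun j hj => by
      have := div_nonneg (hbS j hj) hτ1'.le; linarith
    -- termwise `1 + a + b ≤ 1 + a/τ`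
    have hLPY : L ≤ PY := by
      refine prod_le_prod (fun j hj => by have := haS j hj; have := hbS j hj; linarith) fun j hj => ?_
      have h1 : a j + b j ≤ a j / τ := by
        rw [le_div_iff₀ hτ0]
        have := hlS j hj
        nlinarith
      linarith
    rw [prod_insert hi, prod_insert hi, prod_insert hi]
    -- new right side = old right side + a·PY + b·PH
    have hrhs : τ * ((1 + a i / τ) * PY) + (1 - τ) * ((1 + b i / (1 - τ)) * PH) =
        (τ * PY + (1 - τ) * PH) + (a i * PY + b i * PH) := by
      field_simp
      ring
    rw [hrhs]
    have hkey : (a i + b i) * L ≤ a i * PY + b i * PH := by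
      by_cases hc : L ≤ PH
      · nlinarith [mul_le_mul_of_nonneg_left hLPY hai, mul_le_mul_of_nonneg_left hc hbi]
      · push Not at hc
        -- `b (L - PH) ≤ (a(1-τ)/τ)(L - PH)` and `τ PY + (1-τ) PH ≥ L`
        have h1 : τ * (b i * (L - PH)) ≤ (1 - τ) * a i * (L - PH) := by
          have := mul_le_mul_of_nonneg_right hli (sub_nonneg.2 hc.le)
          nlinarith
        nlinarith [mul_le_mul_of_nonneg_left IH hai]
    nlinarith

/-! ## Monotonicity in the floor mass `ε` -/

/-- Inserting a petal into the one-coin excess `ε·(∏_{j∈S}(1 + a_j/ε) − 1)` (the excess of a one-coin system whose floor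
carries mass `ε`): it grows by `a_i ∏_{j∈S}(1 + a_j/ε)`. [this work] -/
theorem rfun_insert [DecidableEq κ] {S : Finset κ} {i : κ} (hi : i ∉ S) (a : κ → ℝ) {ε : ℝ} (hε : ε ≠ 0) :
    ε * (∏ j ∈ insert i S, (1 + a j / ε) - 1) = ε * (∏ j ∈ S, (1 + a j / ε) - 1) + a i * ∏ j ∈ S, (1 + a j / ε) := by
  rw [prod_insert hi]
  field_simp
  ring

/-- The one-coin product `∏(1 + a_j/ε)` is antitone in `ε > 0`. [this work] -/
theorem prod_anti (S : Finset κ) (a : κ → ℝ) (ha : ∀ j ∈ S, 0 ≤ a j) {ε ε' : ℝ} (hε : 0 < ε) (hεε' : ε ≤ ε') :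
    ∏ j ∈ S, (1 + a j / ε') ≤ ∏ j ∈ S, (1 + a j / ε) := by
  have hε' : 0 < ε' := lt_of_lt_of_le hε hεε'
  refine prod_le_prod (fun j hj => by have := div_nonneg (ha j hj) hε'.le; linarith) fun j hj => ?_
  have : a j / ε' ≤ a j / ε := div_le_div_of_nonneg_left (ha j hj) hε hεε'
  linarith

/-- The one-coin excess `ε·(∏(1 + a_j/ε) − 1)` is antitone in `ε > 0`. [this work] -/
theorem rfun_anti [DecidableEq κ] (S : Finset κ) (a : κ → ℝ) (ha : ∀ j ∈ S, 0 ≤ a j) {ε ε' : ℝ} (hε : 0 < ε)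
    (hεε' : ε ≤ ε') : ε' * (∏ j ∈ S, (1 + a j / ε') - 1) ≤ ε * (∏ j ∈ S, (1 + a j / ε) - 1) := by
  have hε' : 0 < ε' := lt_of_lt_of_le hε hεε'
  induction S using Finset.induction_on with
  | empty => simp
  | @insert i S hi ih =>
    have haS : ∀ j ∈ S, 0 ≤ a j := fun j hj => ha j (mem_insert_of_mem hj)
    rw [rfun_insert hi a hε.ne', rfun_insert hi a hε'.ne']
    have h1 := ih haS
    have h2 := mul_le_mul_of_nonneg_left (prod_anti S a haS hε hεε') (ha i (mem_insert_self i S))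
    linarith

/-! ## The linked two-currency lemma -/

/-- **LINKED TWO-CURRENCY LEMMA.**  `0 < τ < 1`, `0 < ε_Y ≤ τ`, `0 < ε_H ≤ 1 − τ`, petals with `b_j ≥ 0` and the link
`τ b_j ≤ (1−τ) a_j`.  Then
`∏_{j∈S}(1 + a_j + b_j) ≤ 1 + ε_Y (∏_{j∈S}(1 + a_j/ε_Y) − 1) + ε_H (∏_{j∈S}(1 + b_j/ε_H) − 1)`.
The right side is the value of "one petal holding everything" in a pair of one-coin systems whose floors carry the masses
`ε_Y`, `ε_H` of the total floor value `1`; without the link the inequality is the false "two free systems" statement.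
[this work] -/
theorem linked_two_currency [DecidableEq κ] {τ εY εH : ℝ} (hτ0 : 0 < τ) (hτ1 : τ < 1) (hεY : 0 < εY) (hεYτ : εY ≤ τ)
    (hεH : 0 < εH) (hεHτ : εH ≤ 1 - τ) (a b : κ → ℝ) (S : Finset κ) (hb : ∀ j ∈ S, 0 ≤ b j)
    (hlink : ∀ j ∈ S, τ * b j ≤ (1 - τ) * a j) :
    ∏ j ∈ S, (1 + a j + b j) ≤
      1 + εY * (∏ j ∈ S, (1 + a j / εY) - 1) + εH * (∏ j ∈ S, (1 + b j / εH) - 1) := by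
  have hτ1' : 0 < 1 - τ := sub_pos.2 hτ1
  have ha : ∀ j ∈ S, 0 ≤ a j := fun j hj => by
    have h := hlink j hj
    have h2 : 0 ≤ τ * b j := mul_nonneg hτ0.le (hb j hj)
    nlinarith
  have h1 := linked_caps hτ0 hτ1 a b S hb hlink
  have h2 := rfun_anti S a ha hεY hεYτ
  have h3 := rfun_anti S b hb hεH hεHτ
  have h4 : τ * ∏ j ∈ S, (1 + a j / τ) + (1 - τ) * ∏ j ∈ S, (1 + b j / (1 - τ)) =
      1 + τ * (∏ j ∈ S, (1 + a j / τ) - 1) + (1 - τ) * (∏ j ∈ S, (1 + b j / (1 - τ)) - 1) := by ring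
  linarith

/-! ## (RES0′) for petal systems with the `h`-cell at its floor, every number of petals -/

/-- A product over `S` of `c * f j` is `c^|S| * ∏ f`. -/
theorem prod_const_mul' (S : Finset κ) (c : ℝ) (f : κ → ℝ) :
    ∏ j ∈ S, (c * f j) = c ^ S.card * ∏ j ∈ S, f j := by
  rw [prod_mul_distrib, prod_const]

/-- **TWO LINKED SYSTEMS, `h` at floor (all `n`).**  Parameters `τ ∈ (0,1)`, `σ < 1`, `s > 0`, floors
`0 < b_Ȳ`, `b_H = (1−σ)α₀₁ + σα₁₁ > 0`, constant `c₀ ≥ 0`; `p = τ(1−σ)`, `q = s(1−τ)`, `g = c₀ + p b_Ȳ + q b_H`,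
`a = c₀ + p + q`.  Petals `j ∈ S` (`S ≠ ∅`) carry a `Ȳ`-face value `Y_j` and a `g`-cell value `g_j ≥ α₀₁`, LINKED by
`s (g_j − α₀₁) ≤ Y_j − b_Ȳ` (so `Y_j ≥ b_Ȳ`; in the section relaxation `Ȳ_j − b_Ȳ = (1−s)(y_j − α₀₀) + s(k_j − α₀₁)` with
`k_j ≥ g_j`, `y_j ≥ α₀₀`), the `h`-cell being at its floor so that `H_j = (1−σ) g_j + σ α₁₁`.  If the two face budgets
`∏ Y_j ≤ b_Ȳ^(|S|−1)`, `∏ H_j ≤ b_H^(|S|−1)` hold and the floor masses satisfy `(1−σ) b_Ȳ ≤ g` (the leaf-leaf-constant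
condition; false for the bare HCS constant) and `s b_H ≤ g`, then  `∏_{j∈S} (c₀ + p Y_j + q H_j) ≤ g^(|S|−1) · a`.
Proof: `linked_two_currency` with `a_j = p(Y_j − b_Ȳ)/g`, `b_j = q(H_j − b_H)/g`, `ε_Y = p b_Ȳ/g`, `ε_H = q b_H/g`. [this work] -/
theorem res0_hfloor [DecidableEq κ] {τ σ s bY bH α01 α11 c0 : ℝ} (hτ0 : 0 < τ) (hτ1 : τ < 1)
    (hσ1 : σ < 1) (hs0 : 0 < s) (hbY : 0 < bY) (hbH : 0 < bH)
    (hbHdef : bH = (1 - σ) * α01 + σ * α11) (hc0 : 0 ≤ c0)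
    (S : Finset κ) (hS : S.Nonempty) (Y gc : κ → ℝ) (hgb : ∀ j ∈ S, α01 ≤ gc j)
    (hlink : ∀ j ∈ S, s * (gc j - α01) ≤ Y j - bY)
    (hBY : ∏ j ∈ S, Y j ≤ bY ^ (S.card - 1))
    (hBH : ∏ j ∈ S, ((1 - σ) * gc j + σ * α11) ≤ bH ^ (S.card - 1))
    (hεY : (1 - σ) * bY ≤ c0 + τ * (1 - σ) * bY + s * (1 - τ) * bH)
    (hεH : s * bH ≤ c0 + τ * (1 - σ) * bY + s * (1 - τ) * bH) :
    ∏ j ∈ S, (c0 + τ * (1 - σ) * Y j + s * (1 - τ) * ((1 - σ) * gc j + σ * α11)) ≤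
      (c0 + τ * (1 - σ) * bY + s * (1 - τ) * bH) ^ (S.card - 1) * (c0 + τ * (1 - σ) + s * (1 - τ)) := by
  have hτ1' : 0 < 1 - τ := sub_pos.2 hτ1
  have hσ1' : 0 < 1 - σ := sub_pos.2 hσ1
  set p := τ * (1 - σ) with hp
  set q := s * (1 - τ) with hq
  set g := c0 + τ * (1 - σ) * bY + s * (1 - τ) * bH with hg
  have hp0 : 0 < p := mul_pos hτ0 hσ1'
  have hq0 : 0 < q := mul_pos hs0 hτ1'
  have hgeq : g = c0 + p * bY + q * bH := by rw [hg, hp, hq]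
  have hgpos : 0 < g := by rw [hgeq]; nlinarith [mul_pos hp0 hbY, mul_pos hq0 hbH]
  have hgne : g ≠ 0 := hgpos.ne'
  -- normalised excesses
  set a : κ → ℝ := fun j => p * (Y j - bY) / g with ha
  set b : κ → ℝ := fun j => q * ((1 - σ) * (gc j - α01)) / g with hb
  set εY := p * bY / g with hεYd
  set εH := q * bH / g with hεHd
  have hεYpos : 0 < εY := div_pos (mul_pos hp0 hbY) hgpos
  have hεHpos : 0 < εH := div_pos (mul_pos hq0 hbH) hgpos
  have hεYτ : εY ≤ τ := by
    rw [hεYd, div_le_iff₀ hgpos, hp]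
    have := mul_le_mul_of_nonneg_left hεY hτ0.le
    nlinarith
  have hεHτ : εH ≤ 1 - τ := by
    rw [hεHd, div_le_iff₀ hgpos, hq]
    have := mul_le_mul_of_nonneg_left hεH hτ1'.le
    nlinarith
  have hbnn : ∀ j ∈ S, 0 ≤ b j := fun j hj => by
    rw [hb]
    exact div_nonneg (mul_nonneg hq0.le (mul_nonneg hσ1'.le (sub_nonneg.2 (hgb j hj)))) hgpos.le
  have hlink' : ∀ j ∈ S, τ * b j ≤ (1 - τ) * a j := fun j hj => by
    rw [ha, hb]
    rw [show τ * (q * ((1 - σ) * (gc j - α01)) / g) = (τ * (1 - τ) * (1 - σ)) * (s * (gc j - α01)) / g by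
      rw [hq]; ring]
    rw [show (1 - τ) * (p * (Y j - bY) / g) = (τ * (1 - τ) * (1 - σ)) * (Y j - bY) / g by rw [hp]; ring]
    exact div_le_div_of_nonneg_right (mul_le_mul_of_nonneg_left (hlink j hj) (by positivity)) hgpos.le
  have key := linked_two_currency hτ0 hτ1 hεYpos hεYτ hεHpos hεHτ a b S hbnn hlink'
  -- identify the factors
  have hfac : ∀ j ∈ S, c0 + τ * (1 - σ) * Y j + s * (1 - τ) * ((1 - σ) * gc j + σ * α11) = g * (1 + a j + b j) := by
    intro j _
    rw [ha, hb]
    field_simp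
    rw [hgeq, hbHdef, hp, hq]
    ring
  rw [prod_congr rfl hfac, prod_const_mul']
  -- identify the one-coin products
  have hY1 : ∀ j ∈ S, 1 + a j / εY = Y j / bY := by
    intro j _
    rw [ha, hεYd]
    field_simp
    ring
  have hH1 : ∀ j ∈ S, 1 + b j / εH = ((1 - σ) * gc j + σ * α11) / bH := by
    intro j _
    rw [hb, hεHd]
    field_simp
    rw [hbHdef]
    ring
  have hcard : 1 ≤ S.card := Finset.card_pos.2 hS
  have hpowY : bY ^ S.card = bY ^ (S.card - 1) * bY := by
    conv_lhs => rw [show S.card = (S.card - 1) + 1 by omega, pow_succ]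
  have hpowH : bH ^ S.card = bH ^ (S.card - 1) * bH := by
    conv_lhs => rw [show S.card = (S.card - 1) + 1 by omega, pow_succ]
  have hrY : εY * (∏ j ∈ S, (1 + a j / εY) - 1) ≤ p * (1 - bY) / g := by
    rw [prod_congr rfl hY1, prod_div_distrib, prod_const]
    have h1 : (∏ j ∈ S, Y j) / bY ^ S.card ≤ 1 / bY := by
      rw [div_le_div_iff₀ (by positivity) hbY, one_mul, hpowY]
      exact mul_le_mul_of_nonneg_right hBY hbY.le
    have h2 : εY * ((∏ j ∈ S, Y j) / bY ^ S.card - 1) ≤ εY * (1 / bY - 1) :=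
      mul_le_mul_of_nonneg_left (by linarith) hεYpos.le
    refine h2.trans (le_of_eq ?_)
    rw [hεYd]
    field_simp
  have hrH : εH * (∏ j ∈ S, (1 + b j / εH) - 1) ≤ q * (1 - bH) / g := by
    rw [prod_congr rfl hH1, prod_div_distrib, prod_const]
    have h1 : (∏ j ∈ S, ((1 - σ) * gc j + σ * α11)) / bH ^ S.card ≤ 1 / bH := by
      rw [div_le_div_iff₀ (by positivity) hbH, one_mul, hpowH]
      exact mul_le_mul_of_nonneg_right hBH hbH.le
    have h2 : εH * ((∏ j ∈ S, ((1 - σ) * gc j + σ * α11)) / bH ^ S.card - 1) ≤ εH * (1 / bH - 1) :=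
      mul_le_mul_of_nonneg_left (by linarith) hεHpos.le
    refine h2.trans (le_of_eq ?_)
    rw [hεHd]
    field_simp
  have htot : ∏ j ∈ S, (1 + a j + b j) ≤ (c0 + p + q) / g := by
    have h1 : 1 + p * (1 - bY) / g + q * (1 - bH) / g = (c0 + p + q) / g := by
      field_simp
      rw [hgeq]
      ring
    linarith
  have hgpow : g ^ S.card = g ^ (S.card - 1) * g := by
    conv_lhs => rw [show S.card = (S.card - 1) + 1 by omega, pow_succ]
  calc g ^ S.card * ∏ j ∈ S, (1 + a j + b j) ≤ g ^ S.card * ((c0 + p + q) / g) :=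
        mul_le_mul_of_nonneg_left htot (by positivity)
    _ = g ^ (S.card - 1) * (c0 + p + q) := by rw [hgpow]; field_simp
    _ = g ^ (S.card - 1) * (c0 + τ * (1 - σ) + s * (1 - τ)) := by rw [hp, hq]

end LinkedCurrency

end SafeCalc

end Summit.CriticalPhenomena.PercolationContinuityZ3.Theorems.SunflowerPartition
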